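import Summits.SmoothPoincare4.SmoothPoincare4.Theses.CongruenceShadows
import Summits.SmoothPoincare4.SmoothPoincare4.Theorems.WaldhausenPairs.Negative.LoadBearing
import Summits.SmoothPoincare4.SmoothPoincare4.Theorems.CongruenceShadowsHeegaardHandlebodyCongruenceClosedLevelCollapse

/-!
# Stub P1 `stub_pairShadowFiniteQuotients` of line `pair-rigidity-retraction` for crux
`CongruenceShadows.HeegaardHandlebodyCongruenceClosed` (item stmt-SmoothPoincare4-14596, `--supports` the crux)

Notation: `S = S_{3+3m} = SurfaceGroup (3+3m)`, `N = (N₀,N₁,N₂) = s4Kernels.stabilizeIter m` (the standard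
genus-`(3+3m)` trisection kernels of `S⁴`), `θ ∈ Aut S`, `θN₂ = (N 2).map θ`.

**P1 (shadow-standard pairs have the finite quotients of `F_{m+1}`).**  Let `i ≠ 2`.  If at every
characteristic finite-index level `M ≤ S` one automorphism `a_M` carries `(N_i ⊔ M, N₂ ⊔ M)` onto
`(N_i ⊔ M, θN₂ ⊔ M)`, then for every finite group `Q` the twisted pair quotient `S ⧸ ⟪N_i ∪ θN₂⟫` surjects
onto `Q` iff `F_{m+1} ≅ S ⧸ ⟪N_i ∪ N₂⟫` does.

Proof (pure group theory, Dixon–Formanek–Poland–Ribes style): a surjection `F : S ↠ Q` killing `N_i` and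
`θN₂` has finite-index kernel, which contains a characteristic finite-index `M` (cofinality,
`exists_characteristic_le` of the landed `…LevelCollapse`); then `F ∘ a_M` kills `N_i` and `N₂`, so it factors through
`S ⧸ ⟪N_i ∪ N₂⟫ ≅ F_{m+1}`.  The converse uses `a_M⁻¹`.
-/

noncomputable section

-- the prescribed namespace `Summit.<P>.<Sub>.…` duplicates `SmoothPoincare4` (P = Sub)
set_option linter.dupNamespace false

namespace Summit.SmoothPoincare4.SmoothPoincare4.Theorems.HeegaardHandlebodyCongruenceClosed.PairRigidityRetraction

open Literature.Topology.FourManifolds Subgroup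
open Summit.SmoothPoincare4.SmoothPoincare4.Theorems.WaldhausenPairs.Negative (stabilizeIter_isGroupTrisection)

/-! ## Transfer of finite quotients along level automorphisms (abstract group theory) -/

/-- The composite `G ↠ G ⧸ ⟪s⟫ → Q` kills `⟪s⟫`. [folklore] -/
theorem p1_normalClosure_le_ker_comp_mk {G Q : Type*} [Group G] [Group Q] (s : Set G)
    (f : G ⧸ normalClosure s →* Q) :
    normalClosure s ≤ (f.comp (QuotientGroup.mk' (normalClosure s))).ker := fun x hx => by
  rw [MonoidHom.mem_ker, MonoidHom.comp_apply, QuotientGroup.mk'_apply,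
    (QuotientGroup.eq_one_iff x).2 hx, map_one]

/-- If `a` carries `T` onto `L ⊇ K`, then `a⁻¹` carries `K` into `T`. [folklore] -/
theorem p1_map_symm_le {G : Type*} [Group G] (a : G ≃* G) {K L T : Subgroup G}
    (hKL : K ≤ L) (h : T.map a.toMonoidHom = L) : K.map a.symm.toMonoidHom ≤ T := by
  rintro _ ⟨x, hx, rfl⟩
  obtain ⟨y, hy, hyx⟩ := h.ge (hKL hx)
  rw [← hyx, MulEquiv.coe_toMonoidHom, MulEquiv.coe_toMonoidHom, MulEquiv.symm_apply_apply]
  exact hy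

/-- **Transfer.** In a group `G` whose characteristic finite-index subgroups are cofinal among the
finite-index ones, let `A, B, B' ≤ G` be such that at every characteristic finite-index level `M` some
automorphism `a_M` maps `A` into `A ⊔ M` and `B` into `B' ⊔ M`.  Then every surjection `F : G ↠ Q` onto a
finite group killing `A` and `B'` yields a surjection `G ⧸ ⟪A ∪ B⟫ ↠ Q` (namely the factorisation of
`F ∘ a_M` for a characteristic `M ≤ ker F`). [folklore] -/
theorem p1_surjective_transfer {G : Type*} [Group G]
    (hcof : ∀ H : Subgroup G, H.FiniteIndex → ∃ M : Subgroup G, M.Characteristic ∧ M.FiniteIndex ∧ M ≤ H)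
    {A B B' : Subgroup G}
    (h : ∀ M : Subgroup G, M.Characteristic → M.FiniteIndex →
      ∃ a : G ≃* G, A.map a.toMonoidHom ≤ A ⊔ M ∧ B.map a.toMonoidHom ≤ B' ⊔ M)
    {Q : Type*} [Group Q] [Finite Q] (F : G →* Q) (hF : Function.Surjective F)
    (hA : A ≤ F.ker) (hB' : B' ≤ F.ker) :
    ∃ f : G ⧸ normalClosure ((A : Set G) ∪ B) →* Q, Function.Surjective f := by
  obtain ⟨M, hM, hMF, hle⟩ := hcof F.ker inferInstance
  obtain ⟨a, haA, haB⟩ := h M hM hMF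
  have hker : normalClosure ((A : Set G) ∪ B) ≤ (F.comp a.toMonoidHom).ker := by
    refine normalClosure_le_normal ?_
    rintro x (hx | hx) <;> rw [SetLike.mem_coe, MonoidHom.mem_ker, MonoidHom.comp_apply]
    · exact MonoidHom.mem_ker.1 (sup_le hA hle (haA ⟨x, hx, rfl⟩))
    · exact MonoidHom.mem_ker.1 (sup_le hB' hle (haB ⟨x, hx, rfl⟩))
  have hFa : Function.Surjective (F.comp a.toMonoidHom) := fun q => by
    obtain ⟨x, rfl⟩ := hF q
    exact ⟨a.symm x, by simp⟩
  exact ⟨QuotientGroup.lift _ (F.comp a.toMonoidHom) hker,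
    QuotientGroup.lift_surjective_of_surjective _ _ hFa hker⟩

/-! ## P1 for the standard kernels -/

/-- **P1, hypotheses before the colon.**  For `i ≠ 2`, `θ ∈ Aut S_{3+3m}` and a shadow-standard pair
`(N_i, θN₂)`: for every finite group `Q`, `S ⧸ ⟪N_i ∪ θN₂⟫ ↠ Q` exists iff `F_{m+1} ↠ Q` exists
(`F_{m+1} ≅ S ⧸ ⟪N_i ∪ N₂⟫` by `stabilizeIter_isGroupTrisection`, and `p1_surjective_transfer` in both
directions, the backward one with `a_M⁻¹`). [folklore] -/
theorem p1_pairShadowFiniteQuotients (m : ℕ) (i : Fin 3) (hi : i ≠ 2)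
    (θ : SurfaceGroup (3 + 3 * m) ≃* SurfaceGroup (3 + 3 * m))
    (h : ∀ M : Subgroup (SurfaceGroup (3 + 3 * m)), M.Characteristic → M.FiniteIndex →
      ∃ a : SurfaceGroup (3 + 3 * m) ≃* SurfaceGroup (3 + 3 * m),
        (s4Kernels.stabilizeIter m i ⊔ M).map a.toMonoidHom = s4Kernels.stabilizeIter m i ⊔ M ∧
        (s4Kernels.stabilizeIter m 2 ⊔ M).map a.toMonoidHom =
          (s4Kernels.stabilizeIter m 2).map θ.toMonoidHom ⊔ M)
    (Q : Type) [Group Q] [Finite Q] :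
    (∃ f : SurfaceGroup (3 + 3 * m) ⧸ normalClosure
        ((s4Kernels.stabilizeIter m i : Set (SurfaceGroup (3 + 3 * m))) ∪
          ((s4Kernels.stabilizeIter m 2).map θ.toMonoidHom : Subgroup (SurfaceGroup (3 + 3 * m)))) →* Q,
      Function.Surjective f) ↔
    (∃ f : FreeGroup (Fin (m + 1)) →* Q, Function.Surjective f) := by
  obtain ⟨e⟩ := (stabilizeIter_isGroupTrisection m).free_pairQuotient i 2 hi
  have hcof : ∀ H : Subgroup (SurfaceGroup (3 + 3 * m)), H.FiniteIndex →
      ∃ M : Subgroup (SurfaceGroup (3 + 3 * m)), M.Characteristic ∧ M.FiniteIndex ∧ M ≤ H :=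
    fun H hH => @exists_characteristic_le _ H hH
  constructor
  · rintro ⟨f, hf⟩
    have h' : ∀ M : Subgroup (SurfaceGroup (3 + 3 * m)), M.Characteristic → M.FiniteIndex →
        ∃ a : SurfaceGroup (3 + 3 * m) ≃* SurfaceGroup (3 + 3 * m),
          (s4Kernels.stabilizeIter m i).map a.toMonoidHom ≤ s4Kernels.stabilizeIter m i ⊔ M ∧
          (s4Kernels.stabilizeIter m 2).map a.toMonoidHom ≤
            (s4Kernels.stabilizeIter m 2).map θ.toMonoidHom ⊔ M := fun M hM hMF => by
      obtain ⟨a, haA, haB⟩ := h M hM hMF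
      exact ⟨a, (map_mono le_sup_left).trans haA.le, (map_mono le_sup_left).trans haB.le⟩
    obtain ⟨g, hg⟩ := p1_surjective_transfer hcof h' (f.comp (QuotientGroup.mk' _))
      (hf.comp (QuotientGroup.mk'_surjective _))
      (le_trans (fun x hx => subset_normalClosure (Or.inl hx)) (p1_normalClosure_le_ker_comp_mk _ f))
      (le_trans (fun x hx => subset_normalClosure (Or.inr hx)) (p1_normalClosure_le_ker_comp_mk _ f))
    exact ⟨g.comp e.toMonoidHom, hg.comp e.surjective⟩
  · rintro ⟨f, hf⟩
    have h' : ∀ M : Subgroup (SurfaceGroup (3 + 3 * m)), M.Characteristic → M.FiniteIndex →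
        ∃ a : SurfaceGroup (3 + 3 * m) ≃* SurfaceGroup (3 + 3 * m),
          (s4Kernels.stabilizeIter m i).map a.toMonoidHom ≤ s4Kernels.stabilizeIter m i ⊔ M ∧
          ((s4Kernels.stabilizeIter m 2).map θ.toMonoidHom).map a.toMonoidHom ≤
            s4Kernels.stabilizeIter m 2 ⊔ M := fun M hM hMF => by
      obtain ⟨a, haA, haB⟩ := h M hM hMF
      exact ⟨a.symm, p1_map_symm_le a le_sup_left haA, p1_map_symm_le a le_sup_left haB⟩
    exact p1_surjective_transfer hcof h' ((f.comp e.symm.toMonoidHom).comp (QuotientGroup.mk' _))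
      ((hf.comp e.symm.surjective).comp (QuotientGroup.mk'_surjective _))
      (le_trans (fun x hx => subset_normalClosure (Or.inl hx))
        (p1_normalClosure_le_ker_comp_mk _ (f.comp e.symm.toMonoidHom)))
      (le_trans (fun x hx => subset_normalClosure (Or.inr hx))
        (p1_normalClosure_le_ker_comp_mk _ (f.comp e.symm.toMonoidHom)))

/-- **Registered stub P1 of line `pair-rigidity-retraction`** (signature verbatim as registered on
stmt-SmoothPoincare4-14596): a shadow-standard twisted pair `(N_i, θN₂)` (`i ≠ 2`) has pair quotient
`S ⧸ ⟪N_i ∪ θN₂⟫` with exactly the finite quotients of `F_{m+1}`; `= p1_pairShadowFiniteQuotients`. [folklore] -/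
theorem stub_pairShadowFiniteQuotients :
    ∀ (m : ℕ) (i : Fin 3), i ≠ 2 → ∀ θ : SurfaceGroup (3 + 3 * m) ≃* SurfaceGroup (3 + 3 * m),
      (∀ M : Subgroup (SurfaceGroup (3 + 3 * m)), M.Characteristic → M.FiniteIndex →
        ∃ a : SurfaceGroup (3 + 3 * m) ≃* SurfaceGroup (3 + 3 * m),
          (s4Kernels.stabilizeIter m i ⊔ M).map a.toMonoidHom = s4Kernels.stabilizeIter m i ⊔ M ∧
          (s4Kernels.stabilizeIter m 2 ⊔ M).map a.toMonoidHom =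
            (s4Kernels.stabilizeIter m 2).map θ.toMonoidHom ⊔ M) →
      ∀ (Q : Type) [Group Q] [Finite Q],
        (∃ f : SurfaceGroup (3 + 3 * m) ⧸ normalClosure ((s4Kernels.stabilizeIter m i : Set (SurfaceGroup (3 + 3 * m))) ∪
            ((s4Kernels.stabilizeIter m 2).map θ.toMonoidHom : Subgroup (SurfaceGroup (3 + 3 * m)))) →* Q,
          Function.Surjective f) ↔
        (∃ f : FreeGroup (Fin (m + 1)) →* Q, Function.Surjective f) :=
  fun m i hi θ h Q _ _ => p1_pairShadowFiniteQuotients m i hi θ h Q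

end Summit.SmoothPoincare4.SmoothPoincare4.Theorems.HeegaardHandlebodyCongruenceClosed.PairRigidityRetraction

end
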